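import Literature.MathematicalPhysics.QuantumFieldTheory.Balaban1983to89.B6Eq295

/-!
# `Balaban1983to89.B6Eq228FaddeevPopov` — T. Bałaban, *Propagators and renormalization transformations for lattice
# gauge theories. II*, Commun. Math. Phys. **96** (1984) 223–250 [Balaban1984PropagatorsII], Sect. A (2.28)–(2.30)
# p. 227: the Gaussian representation of `R∂*G∂R` and its Faddeev–Popov computation — THE PRINTED DISPLAYS, line by
# line, over the abstract carriers of `…B6Eq295`

statement-level skeleton of published theorems with citation tags; proofs where landed; nothing here is a claim about the Yang–Mills mass gap

PDF held: `paper:balaban1984-cmp96-propagators-rt-ii` (journal page = PDF page + 222); pp. 225–228 read AS IMAGES on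
the ×2 renders `run/shared/lean/pub/pub-balaban/b2b-balaban-ref1/pages/1984-cmp96-propagators-rt-II/…-p003…p006-x2.png`
by this seat (2026-08-21).

CITATION HEADER (lean-in-tree rule).  WHAT IS REPRODUCED: lit-balaban SKELETON rows **B6.Eq2.31** ((2.28)–(2.31)) and
**B6.Eq2.34** ((2.32)–(2.34)), whose heads `R∂*G∂R = R`, `R∂*GQ* = 0`, `QG∂R = 0` are the ALGEBRAIC theorems of record
`…B6Eq231.eq231` / `eq234_left` / `eq234_right` (r03, p239491; cell note: *"PROVED algebraically (not via the printed
Gaussian integrals (2.28)–(2.30))"*, census C-B6-2 *"Gaussian derivation absent"*).  THIS file and its two sequels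
`…B6Eq230GaussianRoute` ((2.29)/(2.30) assembled ⇒ (2.31)) and `…B6Eq233GaussianRoute` ((2.32)–(2.33) ⇒ (2.34), with
the Gaussian moments of `…B6Eq232GaussianMoment`) supply the PRINTED route.  PHASE-2 seat p22 (gen 4); owner r03,
referee ref-4.  Conventions = `…B6Eq295` §1–§2 (IMPORTED; its `eq224`, `eq225`, `integral_exp_quadratic_add_linear`,
`integral_exp_neg_half_norm_sub_sq` are consumed by name): `∫dλ δ(Q′λ) F(λ)` = `∫ l, F l ∂ν` over an abstract additive
group `N` (= N(Q′)) with a left-invariant measure `ν`, `D : N →ₗ V` = Δ on N(Q′), `ΔN(Q′) = range D = K`, `R` = the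
orthogonal projection onto `K` (`Submodule.starProjection`, (2.10)); `∫dA` = an integral over the configuration space `A`
against a left-invariant `μ`.  Nothing of any existing module is restated or modified.

PRINT (p. 227 [PDF 5], verbatim).  *"Let us consider the operator R∂*G∂R. We have
  e^{½⟨f,R∂*G∂Rf⟩} = Z⁻¹∫dA e^{−½⟨A,Δ_aA⟩+⟨f,R∂*A⟩}
   = Z⁻¹∫dA e^{−½‖∂A‖²−½a‖QA‖²} e^{−½‖∂*A‖²+⟨f,R∂*A⟩} · Z′⁻¹(∫dλδ(Q′λ)e^{−½‖∂*A−Δλ‖²})⁻¹.   (2.28)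
Applying the Faddeev-Popov procedure we change the Gaussian gauge fixing term in this integral into the δ-function
δ_R(R∂*A). Let us recall that δ_R is a δ-function at the origin of the real, finite-dimensional Hilbert space R. We have
  |det(Δ↾_{N(Q′)})| ∫dλ′δ(Q′λ′)δ_R(R∂*A + Δλ′) = 1   (2.29)
(see the proof of the formula (1.46) in [4]) and we insert the expression above into the integral in (2.28). We change
the order of integrations ∫dA∫dλ′… = ∫dλ′∫dA…, next we make the gauge transformation A → A^{λ′} = A − ∂λ′, and we
again change the order of the integrations. Because Q′λ′ = 0, hence QA^{λ′} = QA − ∂₁Q′λ′ = QA, and we get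
  e^{½⟨f,R∂*G∂Rf⟩}
   = Z⁻¹|det(Δ↾_{N(Q′)})|Z′∫dA e^{−½‖∂A‖²−½a‖QA‖²}δ_R(R∂*A)
     · ∫dλ′δ(Q′λ′)e^{−½‖∂*A−Δλ′‖²+⟨f,R∂*A−Δλ′⟩} (∫dλδ(Q′λ)e^{−½‖∂*A−Δλ′−Δλ‖²})⁻¹
   = Z⁻¹|det(Δ↾_{N(Q′)})|Z′∫dA e^{−½‖∂A‖²−½a‖QA‖²}δ_R(R∂*A)
     · ∫dλ′δ(Q′λ′)e^{−½‖Δλ′‖²+⟨Δ∂*A,λ′⟩−⟨Δf,λ′⟩} (∫dλδ(Q′λ)e^{−½‖Δλ‖²+⟨Δ∂*A,λ⟩})⁻¹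
   = Z⁻¹|det(Δ↾_{N(Q′)})|Z′∫dA e^{−½‖∂A‖²−½a‖QA‖²}δ_R(R∂*A) · e^{−⟨Δ∂*A,𝒢Δf⟩+½⟨Δf,𝒢Δf⟩} = e^{½⟨f,Rf⟩}.   (2.30)
The last equality follows from the identity (2.26) and from the presence of the δ-function δ_R(R∂*A). Thus
R∂*G∂R = R. (2.31)"*.  Inputs quoted: (2.19) p. 226 *"Δ_a = ∂*∂ + ∂R∂* + Q*aQ"*, i.e. `⟨A,Δ_aA⟩ = ‖∂A‖² + ⟨∂*A,R∂*A⟩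
+ ⟨QA,aQA⟩`; (2.22) `G = Δ_a⁻¹`; (2.24)–(2.26) p. 226 (`…B6Eq295.eq224/eq225`, *"𝒢 a covariance … R = Δ𝒢Δ (2.26)"*);
p. 225 *"let R be an orthogonal projection … onto the subspace ΔN(Q′) … the Laplace operator Δ is positive on the
subspace N(Q′), hence it is invertible on this subspace"*.

READING NOTES (not objections).  (a) (2.28) prints `Z′⁻¹(∫dλ…)⁻¹`; by (2.24) (`e^{−½⟨g,Rg⟩} = e^{−½‖g‖²}(Z′⁻¹∫…)⁻¹`)
and by the prefactor `Z⁻¹|det(Δ↾N(Q′))|Z′` of (2.30) the parenthesis opens before `Z′⁻¹`: the factor is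
`(Z′⁻¹∫dλ…)⁻¹ = Z′(∫dλ…)⁻¹`, typed so (`eq228_second`).  (b) `‖∂A‖²` on vector fields is the curl part; it is typed as
`‖curl A‖²` for an abstract linear `curl : A → T` with `curl ∂λ = 0` (∂∂ = 0); `QA` gauge invariant for `λ ∈ N(Q′)`
(*"Because Q′λ′ = 0"*) is the hypothesis `Q(∂λ) = 0`; `Δλ = ∂*∂λ` ((2.8)) is `∂*(dN l) = D l`.  (c) The scalar `a` of
print is typed as an operator on the average space (`⟨QA,aQA⟩`, as in `…B6Eq295.eq295_first`).

CONTENTS (all theorems, no definitions, no deferred proofs).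
§1 gauge algebra: `R_apply_D` (RΔλ = Δλ), `R_symm`, `inner_dstar_D_of_slice` (⟨∂*A,Δλ⟩ = 0 when R∂*A = 0), `G_symm`,
   `R_dstar_gauge` (R∂*A^{λ′} = R∂*A − Δλ′), `form_gauge` (⟨A^{λ′},Δ_aA^{λ′}⟩ on the slice), **`existsUnique_229`** (the
   δ-function of (2.29) has exactly one zero: Δ injective on N(Q′) with range ΔN(Q′)).
§2 **(2.28)**: `eq228_first` (first equality = Gaussian moment-generating function with source ∂Rf), `eq228_second_mul`
   / `eq228_second` (second equality, pointwise, by (2.24)), `eq228` (both, as an identity of integrals).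
§3 **(2.30) pointwise**: `eq230_line1` (gauge transformation), `eq230_line2` (expansion on the support of δ_R,
   translation λ → λ − λ′), `eq230_line3` (the two λ-Gaussians by (2.25)), `eq230_line3_calG` / `eq230_last` (the
   printed 𝒢-form via (2.26) and the δ_R-support), `orbit_integral_230` (the orbit integral of the (2.28)₁ integrand).
The assembly — the change of variables (2.29), Fubini, the normalisation `f = 0`, `e^{½⟨f,R∂*G∂Rf⟩} = e^{½⟨f,Rf⟩}`
and (2.31) — is `…B6Eq230GaussianRoute`.  HONEST SCOPE: the identification of `A, V, W, T, N, curl, ∂, ∂*, Q, D` with the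
lattice objects of (2.5)–(2.20) is not made here (abstract carriers, as in `…B6Eq295`); value = kernel certificate of the
displayed computation, NOT summit progress.  Unit `lit-balaban-p22` (gen 4), HOME `run/shared/lean/pub/lit-balaban/`.
-/

noncomputable section

open MeasureTheory
open scoped InnerProductSpace

namespace Literature.MathematicalPhysics.QuantumFieldTheory.Balaban1983to89.B6Eq228FaddeevPopov

/-! ## §1  Gauge algebra on the abstract carriers -/

section GaugeAlgebra

variable {V A W T N : Type*} [NormedAddCommGroup V] [InnerProductSpace ℝ V] [NormedAddCommGroup A]
  [InnerProductSpace ℝ A] [NormedAddCommGroup W] [InnerProductSpace ℝ W] [NormedAddCommGroup T]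
  [InnerProductSpace ℝ T] [AddCommGroup N] [Module ℝ N]

/-- `R` fixes `ΔN(Q′) = range D`: `R(Δλ) = Δλ` (R = the orthogonal projection onto ΔN(Q′), p. 225).
[cite: Balaban1984PropagatorsII, (2.10) p.225] -/
theorem R_apply_D (D : N →ₗ[ℝ] V) (K : Submodule ℝ V) [K.HasOrthogonalProjection]
    (hK : LinearMap.range D = K) (Rp : V →ₗ[ℝ] V) (hR : ∀ g, Rp g = K.starProjection g) (l : N) :
    Rp (D l) = D l := by
  rw [hR]
  exact Submodule.starProjection_eq_self_iff.mpr (hK ▸ LinearMap.mem_range_self D l)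

/-- `R` is symmetric (an orthogonal projection). [cite: Balaban1984PropagatorsII, (2.10) p.225] -/
theorem R_symm (K : Submodule ℝ V) [K.HasOrthogonalProjection] (Rp : V →ₗ[ℝ] V)
    (hR : ∀ g, Rp g = K.starProjection g) (x y : V) : ⟪Rp x, y⟫_ℝ = ⟪x, Rp y⟫_ℝ := by
  rw [hR, hR]
  exact Submodule.inner_starProjection_left_eq_right K x y

/-- On the support of `δ_R(R∂*A)` (`R∂*A = 0`): `⟨∂*A, Δλ⟩ = 0` for every `λ ∈ N(Q′)`.
[cite: Balaban1984PropagatorsII, (2.30) p.227] -/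
theorem inner_dstar_D_of_slice (D : N →ₗ[ℝ] V) (K : Submodule ℝ V) [K.HasOrthogonalProjection]
    (hK : LinearMap.range D = K) (Rp : V →ₗ[ℝ] V) (hR : ∀ g, Rp g = K.starProjection g)
    {g : V} (hs : Rp g = 0) (l : N) : ⟪g, D l⟫_ℝ = 0 := by
  rw [← R_apply_D D K hK Rp hR l, ← R_symm K Rp hR, hs, inner_zero_left]

/-- `G = Δ_a⁻¹` ((2.22)) is symmetric when `Δ_a` is: `⟨Gx,y⟩ = ⟨Gx,Δ_aGy⟩ = ⟨Δ_aGx,Gy⟩ = ⟨x,Gy⟩`.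
[cite: Balaban1984PropagatorsII, (2.22) p.226] -/
theorem G_symm (M G : A →ₗ[ℝ] A) (hM : ∀ x y : A, ⟪M x, y⟫_ℝ = ⟪x, M y⟫_ℝ)
    (hMG : M ∘ₗ G = LinearMap.id) (x y : A) : ⟪G x, y⟫_ℝ = ⟪x, G y⟫_ℝ := by
  have h : ∀ z, M (G z) = z := fun z => by simpa using LinearMap.congr_fun hMG z
  conv_lhs => rw [← h y]
  rw [← hM, h x]

/-- The gauge transformation `A → A^{λ′} = A − ∂λ′` on the gauge-fixing function: `R∂*A^{λ′} = R∂*A − Δλ′`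
(`Δλ′ = ∂*∂λ′ ∈ ΔN(Q′)` is fixed by `R`). [cite: Balaban1984PropagatorsII, (2.30) p.227] -/
theorem R_dstar_gauge (D : N →ₗ[ℝ] V) (K : Submodule ℝ V) [K.HasOrthogonalProjection]
    (hK : LinearMap.range D = K) (Rp : V →ₗ[ℝ] V) (hR : ∀ g, Rp g = K.starProjection g)
    (dstar : A →ₗ[ℝ] V) (dN : N →ₗ[ℝ] A) (hD : ∀ l, dstar (dN l) = D l) (v : A) (l : N) :
    Rp (dstar (v - dN l)) = Rp (dstar v) - D l := by
  rw [map_sub, map_sub, hD, R_apply_D D K hK Rp hR]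

/-- The form `⟨A,Δ_aA⟩ = ‖∂A‖² + ⟨∂*A,R∂*A⟩ + ⟨QA,aQA⟩` ((2.19)) at a gauge transform `A₀ − ∂λ′` of a configuration
on the support of `δ_R(R∂*A₀)`: `= ‖∂A₀‖² + ⟨QA₀,aQA₀⟩ + ‖Δλ′‖²` (`∂∂λ′ = 0`, *"QA^{λ′} = QA − ∂₁Q′λ′ = QA"*,
`R∂*(A₀ − ∂λ′) = −Δλ′`). [cite: Balaban1984PropagatorsII, (2.30) p.227] -/
theorem form_gauge (M : A →ₗ[ℝ] A) (curl : A →ₗ[ℝ] T) (dstar : A →ₗ[ℝ] V) (Rp : V →ₗ[ℝ] V)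
    (Q : A →ₗ[ℝ] W) (a : W →ₗ[ℝ] W) (D : N →ₗ[ℝ] V) (dN : N →ₗ[ℝ] A) (K : Submodule ℝ V)
    [K.HasOrthogonalProjection] (hK : LinearMap.range D = K) (hR : ∀ g, Rp g = K.starProjection g)
    (hform : ∀ v, ⟪v, M v⟫_ℝ = ‖curl v‖ ^ 2 + ⟪dstar v, Rp (dstar v)⟫_ℝ + ⟪Q v, a (Q v)⟫_ℝ)
    (hcurl : ∀ l, curl (dN l) = 0) (hQ : ∀ l, Q (dN l) = 0) (hD : ∀ l, dstar (dN l) = D l)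
    {v : A} (hs : Rp (dstar v) = 0) (l : N) :
    ⟪v - dN l, M (v - dN l)⟫_ℝ = ‖curl v‖ ^ 2 + ⟪Q v, a (Q v)⟫_ℝ + ‖D l‖ ^ 2 := by
  have h1 : curl (v - dN l) = curl v := by rw [map_sub, hcurl, sub_zero]
  have h2 : Q (v - dN l) = Q v := by rw [map_sub, hQ, sub_zero]
  have h3 : dstar (v - dN l) = dstar v - D l := by rw [map_sub, hD]
  have h4 : Rp (dstar (v - dN l)) = -D l := by rw [R_dstar_gauge D K hK Rp hR dstar dN hD, hs, zero_sub]
  rw [hform, h1, h2, h4, h3, inner_neg_right, inner_sub_left, real_inner_self_eq_norm_sq,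
    inner_dstar_D_of_slice D K hK Rp hR hs l]
  ring

/-- **(2.29), the zero of the `δ`-function `δ_R(R∂*A + Δλ′)`:** for every configuration there is EXACTLY ONE gauge
function `λ′ ∈ N(Q′)` with `R∂*A + Δλ′ = 0` — Δ is injective on `N(Q′)` (*"the Laplace operator Δ is positive on the
subspace N(Q′), hence it is invertible on this subspace"*, p. 225) with range `ΔN(Q′)` = range `R`.  This is the content
of the unit `|det(Δ↾_{N(Q′)})|∫dλ′δ(Q′λ′)δ_R(R∂*A + Δλ′) = 1` up to the normalisation of the flat measures (the constant
Jacobian: `…B6Eq230GaussianRoute.fp_decomposition`). [cite: Balaban1984PropagatorsII, (2.29) p.227] -/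
theorem existsUnique_229 (D : N →ₗ[ℝ] V) (K : Submodule ℝ V) [K.HasOrthogonalProjection]
    (hK : LinearMap.range D = K) (Rp : V →ₗ[ℝ] V) (hR : ∀ g, Rp g = K.starProjection g)
    (hDinj : Function.Injective D) (g : V) : ∃! l : N, Rp g + D l = 0 := by
  obtain ⟨l₀, hl₀⟩ : ∃ l₀, D l₀ = Rp g := by
    have hmem : Rp g ∈ LinearMap.range D := by rw [hK, hR]; exact K.starProjection_apply_mem g
    exact LinearMap.mem_range.mp hmem
  refine ⟨-l₀, show Rp g + D (-l₀) = 0 by rw [map_neg, hl₀, add_neg_cancel], fun l hl => ?_⟩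
  apply hDinj
  rw [map_neg, hl₀]
  exact eq_neg_of_add_eq_zero_right hl

end GaugeAlgebra

/-! ## §2  (2.28): the Gaussian representation of `R∂*G∂R`, both equalities -/

section Display228

variable {V A W T N : Type*} [NormedAddCommGroup V] [InnerProductSpace ℝ V] [NormedAddCommGroup A]
  [InnerProductSpace ℝ A] [MeasurableSpace A] [MeasurableAdd A] [NormedAddCommGroup W] [InnerProductSpace ℝ W]
  [NormedAddCommGroup T] [InnerProductSpace ℝ T] [AddCommGroup N] [Module ℝ N] [MeasurableSpace N]
  [MeasurableAdd N]

/-- **(2.28), first equality:** `e^{½⟨f,R∂*G∂Rf⟩}·Z = ∫dA e^{−½⟨A,Δ_aA⟩ + ⟨f,R∂*A⟩}`, `Z = ∫dA e^{−½⟨A,Δ_aA⟩}` — the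
Gaussian moment-generating function with the source `∂Rf` (`⟨f,R∂*A⟩ = ⟨∂Rf, A⟩`), for every left-invariant `dA`,
`Δ_a` (= `M`) symmetric and `G = Δ_a⁻¹` (`MG = I`). [cite: Balaban1984PropagatorsII, (2.28) p.227] -/
theorem eq228_first (μ : Measure A) [μ.IsAddLeftInvariant] (M G : A →ₗ[ℝ] A) (d : V →ₗ[ℝ] A)
    (dstar : A →ₗ[ℝ] V) (Rp : V →ₗ[ℝ] V) (K : Submodule ℝ V) [K.HasOrthogonalProjection]
    (hR : ∀ g, Rp g = K.starProjection g) (hadj : ∀ (v : A) (g : V), ⟪v, d g⟫_ℝ = ⟪dstar v, g⟫_ℝ)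
    (hM : ∀ x y : A, ⟪M x, y⟫_ℝ = ⟪x, M y⟫_ℝ) (hMG : M ∘ₗ G = LinearMap.id) (f : V) :
    Real.exp ((1 / 2) * ⟪f, (Rp ∘ₗ dstar ∘ₗ G ∘ₗ d ∘ₗ Rp) f⟫_ℝ) * ∫ v, Real.exp (-(1 / 2) * ⟪v, M v⟫_ℝ) ∂μ =
      ∫ v, Real.exp (-(1 / 2) * ⟪v, M v⟫_ℝ + ⟪f, Rp (dstar v)⟫_ℝ) ∂μ := by
  have hsrc : ∀ v, ⟪f, Rp (dstar v)⟫_ℝ = ⟪v, d (Rp f)⟫_ℝ := fun v => by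
    rw [← R_symm K Rp hR, hadj, real_inner_comm]
  simp_rw [hsrc]
  rw [B6Eq295.integral_exp_quadratic_add_linear μ M G hM hMG (d (Rp f))]
  congr 2
  simp only [LinearMap.coe_comp, Function.comp_apply]
  rw [hsrc, real_inner_comm]

omit [MeasurableSpace A] [MeasurableAdd A] in
/-- **(2.28), second equality, pointwise and multiplicative:** with the three-term form
`⟨A,Δ_aA⟩ = ‖∂A‖² + ⟨∂*A,R∂*A⟩ + ⟨QA,aQA⟩` ((2.19)) and (2.24) for `e^{−½⟨∂*A,R∂*A⟩}`:
`e^{−½⟨A,Δ_aA⟩+⟨f,R∂*A⟩} · ∫dλδ(Q′λ)e^{−½‖∂*A−Δλ‖²} = e^{−½‖∂A‖²−½⟨QA,aQA⟩} e^{−½‖∂*A‖²+⟨f,R∂*A⟩} Z′`,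
`Z′ = ∫dλδ(Q′λ)e^{−½‖Δλ‖²}` (any left-invariant `dλ` on `N(Q′)`). [cite: Balaban1984PropagatorsII, (2.28) p.227] -/
theorem eq228_second_mul (ν : Measure N) [ν.IsAddLeftInvariant] (M : A →ₗ[ℝ] A) (curl : A →ₗ[ℝ] T)
    (dstar : A →ₗ[ℝ] V) (Rp : V →ₗ[ℝ] V) (Q : A →ₗ[ℝ] W) (a : W →ₗ[ℝ] W) (D : N →ₗ[ℝ] V)
    (K : Submodule ℝ V) [K.HasOrthogonalProjection] (hK : LinearMap.range D = K)
    (hR : ∀ g, Rp g = K.starProjection g)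
    (hform : ∀ v, ⟪v, M v⟫_ℝ = ‖curl v‖ ^ 2 + ⟪dstar v, Rp (dstar v)⟫_ℝ + ⟪Q v, a (Q v)⟫_ℝ) (f : V) (v : A) :
    Real.exp (-(1 / 2) * ⟪v, M v⟫_ℝ + ⟪f, Rp (dstar v)⟫_ℝ) * ∫ l, Real.exp (-(1 / 2) * ‖dstar v - D l‖ ^ 2) ∂ν =
      Real.exp (-(1 / 2) * ‖curl v‖ ^ 2 - (1 / 2) * ⟪Q v, a (Q v)⟫_ℝ) *
        (Real.exp (-(1 / 2) * ‖dstar v‖ ^ 2 + ⟪f, Rp (dstar v)⟫_ℝ) *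
          ∫ l, Real.exp (-(1 / 2) * ‖D l‖ ^ 2) ∂ν) := by
  have h224 := B6Eq295.eq224 ν D K hK Rp hR (dstar v)
  -- e^{−½‖g‖²}Z′ = e^{−½⟨g,Rg⟩}∫e^{−½‖g−Dl‖²}
  have hsplit : Real.exp (-(1 / 2) * ⟪v, M v⟫_ℝ + ⟪f, Rp (dstar v)⟫_ℝ) =
      Real.exp (-(1 / 2) * ‖curl v‖ ^ 2 - (1 / 2) * ⟪Q v, a (Q v)⟫_ℝ) * Real.exp ⟪f, Rp (dstar v)⟫_ℝ *
        Real.exp (-(1 / 2) * ⟪dstar v, Rp (dstar v)⟫_ℝ) := by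
    rw [← Real.exp_add, ← Real.exp_add, hform]; congr 1; ring
  rw [hsplit, mul_assoc, ← h224, Real.exp_add]
  ring

omit [MeasurableSpace A] [MeasurableAdd A] in
/-- **(2.28), second equality, as printed (quotient form):** under `Z′ ≠ 0` the integrand of (2.28)₁ equals
`e^{−½‖∂A‖²−½⟨QA,aQA⟩} e^{−½‖∂*A‖²+⟨f,R∂*A⟩} · Z′ (∫dλδ(Q′λ)e^{−½‖∂*A−Δλ‖²})⁻¹` — print: *"= Z⁻¹∫dA e^{−½‖∂A‖²
−½a‖QA‖²}e^{−½‖∂*A‖²+⟨f,R∂*A⟩}·Z′⁻¹(∫dλδ(Q′λ)e^{−½‖∂*A−Δλ‖²})⁻¹ (2.28)"*; the printed `Z′⁻¹(∫…)⁻¹` is read as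
`(Z′⁻¹∫…)⁻¹ = Z′(∫…)⁻¹`, the only reading consistent with (2.24) and with the prefactor `Z⁻¹|det(Δ↾N(Q′))|Z′` of (2.30).
[cite: Balaban1984PropagatorsII, (2.28) p.227] -/
theorem eq228_second (ν : Measure N) [ν.IsAddLeftInvariant] (M : A →ₗ[ℝ] A) (curl : A →ₗ[ℝ] T)
    (dstar : A →ₗ[ℝ] V) (Rp : V →ₗ[ℝ] V) (Q : A →ₗ[ℝ] W) (a : W →ₗ[ℝ] W) (D : N →ₗ[ℝ] V)
    (K : Submodule ℝ V) [K.HasOrthogonalProjection] (hK : LinearMap.range D = K)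
    (hR : ∀ g, Rp g = K.starProjection g)
    (hform : ∀ v, ⟪v, M v⟫_ℝ = ‖curl v‖ ^ 2 + ⟪dstar v, Rp (dstar v)⟫_ℝ + ⟪Q v, a (Q v)⟫_ℝ)
    (hZ' : ∫ l, Real.exp (-(1 / 2) * ‖D l‖ ^ 2) ∂ν ≠ 0) (f : V) (v : A) :
    Real.exp (-(1 / 2) * ⟪v, M v⟫_ℝ + ⟪f, Rp (dstar v)⟫_ℝ) =
      Real.exp (-(1 / 2) * ‖curl v‖ ^ 2 - (1 / 2) * ⟪Q v, a (Q v)⟫_ℝ) *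
        (Real.exp (-(1 / 2) * ‖dstar v‖ ^ 2 + ⟪f, Rp (dstar v)⟫_ℝ) *
          (∫ l, Real.exp (-(1 / 2) * ‖D l‖ ^ 2) ∂ν) * (∫ l, Real.exp (-(1 / 2) * ‖dstar v - D l‖ ^ 2) ∂ν)⁻¹) := by
  have hI : ∫ l, Real.exp (-(1 / 2) * ‖dstar v - D l‖ ^ 2) ∂ν ≠ 0 := by
    rw [B6Eq295.integral_exp_neg_half_norm_sub_sq ν D K hK (dstar v)]
    exact mul_ne_zero (Real.exp_ne_zero _) hZ'
  have h := eq228_second_mul ν M curl dstar Rp Q a D K hK hR hform f v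
  have h2 := (eq_mul_inv_iff_mul_eq₀ hI).mpr h
  rw [h2]
  ring

/-- **(2.28) as an identity of integrals** (both printed equalities): for `Z′ ≠ 0`,
`e^{½⟨f,R∂*G∂Rf⟩}·Z = ∫dA e^{−½‖∂A‖²−½⟨QA,aQA⟩}e^{−½‖∂*A‖²+⟨f,R∂*A⟩}·Z′(∫dλδ(Q′λ)e^{−½‖∂*A−Δλ‖²})⁻¹`.
[cite: Balaban1984PropagatorsII, (2.28) p.227] -/
theorem eq228 (μ : Measure A) [μ.IsAddLeftInvariant] (ν : Measure N) [ν.IsAddLeftInvariant]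
    (M G : A →ₗ[ℝ] A) (curl : A →ₗ[ℝ] T) (d : V →ₗ[ℝ] A) (dstar : A →ₗ[ℝ] V) (Rp : V →ₗ[ℝ] V)
    (Q : A →ₗ[ℝ] W) (a : W →ₗ[ℝ] W) (D : N →ₗ[ℝ] V) (K : Submodule ℝ V) [K.HasOrthogonalProjection]
    (hK : LinearMap.range D = K) (hR : ∀ g, Rp g = K.starProjection g)
    (hadj : ∀ (v : A) (g : V), ⟪v, d g⟫_ℝ = ⟪dstar v, g⟫_ℝ)
    (hM : ∀ x y : A, ⟪M x, y⟫_ℝ = ⟪x, M y⟫_ℝ) (hMG : M ∘ₗ G = LinearMap.id)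
    (hform : ∀ v, ⟪v, M v⟫_ℝ = ‖curl v‖ ^ 2 + ⟪dstar v, Rp (dstar v)⟫_ℝ + ⟪Q v, a (Q v)⟫_ℝ)
    (hZ' : ∫ l, Real.exp (-(1 / 2) * ‖D l‖ ^ 2) ∂ν ≠ 0) (f : V) :
    Real.exp ((1 / 2) * ⟪f, (Rp ∘ₗ dstar ∘ₗ G ∘ₗ d ∘ₗ Rp) f⟫_ℝ) * ∫ v, Real.exp (-(1 / 2) * ⟪v, M v⟫_ℝ) ∂μ =
      ∫ v, Real.exp (-(1 / 2) * ‖curl v‖ ^ 2 - (1 / 2) * ⟪Q v, a (Q v)⟫_ℝ) *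
        (Real.exp (-(1 / 2) * ‖dstar v‖ ^ 2 + ⟪f, Rp (dstar v)⟫_ℝ) *
          (∫ l, Real.exp (-(1 / 2) * ‖D l‖ ^ 2) ∂ν) *
            (∫ l, Real.exp (-(1 / 2) * ‖dstar v - D l‖ ^ 2) ∂ν)⁻¹) ∂μ := by
  rw [eq228_first μ M G d dstar Rp K hR hadj hM hMG f]
  refine integral_congr_ae (ae_of_all _ fun v => ?_)
  exact eq228_second ν M curl dstar Rp Q a D K hK hR hform hZ' f v

end Display228

/-! ## §3  (2.30), line by line, at a configuration of the slice `{R∂*A = 0}` -/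

section Display230Pointwise

variable {V A W T N : Type*} [NormedAddCommGroup V] [InnerProductSpace ℝ V] [NormedAddCommGroup A]
  [InnerProductSpace ℝ A] [NormedAddCommGroup W] [InnerProductSpace ℝ W]
  [NormedAddCommGroup T] [InnerProductSpace ℝ T] [AddCommGroup N] [Module ℝ N] [MeasurableSpace N]
  [MeasurableAdd N]

omit [MeasurableAdd N] in
/-- **(2.30), first line (the gauge transformation `A → A^{λ′} = A − ∂λ′` in the integrand of (2.28)₂):** since
`∂∂λ′ = 0`, `QA^{λ′} = QA − ∂₁Q′λ′ = QA` (*"Because Q′λ′ = 0"*) and `∂*A^{λ′} = ∂*A − Δλ′`, `R∂*A^{λ′} = R∂*A − Δλ′`: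
`[e^{−½‖∂·‖²−½⟨Q·,aQ·⟩}e^{−½‖∂*·‖²+⟨f,R∂*·⟩}Z′(∫dλδ(Q′λ)e^{−½‖∂*·−Δλ‖²})⁻¹](A^{λ′})
 = e^{−½‖∂A‖²−½⟨QA,aQA⟩} · e^{−½‖∂*A−Δλ′‖²+⟨f,R∂*A−Δλ′⟩} Z′ (∫dλδ(Q′λ)e^{−½‖∂*A−Δλ′−Δλ‖²})⁻¹`.
[cite: Balaban1984PropagatorsII, (2.30) p.227] -/
theorem eq230_line1 (ν : Measure N) (curl : A →ₗ[ℝ] T) (dstar : A →ₗ[ℝ] V) (Rp : V →ₗ[ℝ] V)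
    (Q : A →ₗ[ℝ] W) (a : W →ₗ[ℝ] W) (D : N →ₗ[ℝ] V) (dN : N →ₗ[ℝ] A) (K : Submodule ℝ V)
    [K.HasOrthogonalProjection] (hK : LinearMap.range D = K) (hR : ∀ g, Rp g = K.starProjection g)
    (hcurl : ∀ l, curl (dN l) = 0) (hQ : ∀ l, Q (dN l) = 0) (hD : ∀ l, dstar (dN l) = D l) (Z' : ℝ) (f : V)
    (v : A) (l' : N) :
    Real.exp (-(1 / 2) * ‖curl (v - dN l')‖ ^ 2 - (1 / 2) * ⟪Q (v - dN l'), a (Q (v - dN l'))⟫_ℝ) *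
        (Real.exp (-(1 / 2) * ‖dstar (v - dN l')‖ ^ 2 + ⟪f, Rp (dstar (v - dN l'))⟫_ℝ) * Z' *
          (∫ l, Real.exp (-(1 / 2) * ‖dstar (v - dN l') - D l‖ ^ 2) ∂ν)⁻¹) =
      Real.exp (-(1 / 2) * ‖curl v‖ ^ 2 - (1 / 2) * ⟪Q v, a (Q v)⟫_ℝ) *
        (Real.exp (-(1 / 2) * ‖dstar v - D l'‖ ^ 2 + ⟪f, Rp (dstar v) - D l'⟫_ℝ) * Z' *
          (∫ l, Real.exp (-(1 / 2) * ‖dstar v - D l' - D l‖ ^ 2) ∂ν)⁻¹) := by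
  rw [R_dstar_gauge D K hK Rp hR dstar dN hD v l', map_sub curl, hcurl, sub_zero, map_sub Q, hQ, sub_zero,
    map_sub dstar, hD]

/-- **(2.30), second line (on the support of `δ_R(R∂*A)`):** for `R∂*A = 0`, expanding the squares and translating
`λ → λ − λ′` in the denominator (the factors `e^{−½‖∂*A‖²}` cancel),
`e^{−½‖∂*A−Δλ′‖²+⟨f,R∂*A−Δλ′⟩} Z′ (∫dλδ(Q′λ)e^{−½‖∂*A−Δλ′−Δλ‖²})⁻¹
 = e^{−½‖Δλ′‖²+⟨Δ∂*A,λ′⟩−⟨Δf,λ′⟩} Z′ (∫dλδ(Q′λ)e^{−½‖Δλ‖²+⟨Δ∂*A,λ⟩})⁻¹` (`⟨Δg,λ⟩ = ⟨g,Δλ⟩`).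
[cite: Balaban1984PropagatorsII, (2.30) p.227] -/
theorem eq230_line2 (ν : Measure N) [ν.IsAddLeftInvariant] (dstar : A →ₗ[ℝ] V) (Rp : V →ₗ[ℝ] V)
    (D : N →ₗ[ℝ] V) {v : A} (hs : Rp (dstar v) = 0) (Z' : ℝ) (f : V) (l' : N) :
    Real.exp (-(1 / 2) * ‖dstar v - D l'‖ ^ 2 + ⟪f, Rp (dstar v) - D l'⟫_ℝ) * Z' *
        (∫ l, Real.exp (-(1 / 2) * ‖dstar v - D l' - D l‖ ^ 2) ∂ν)⁻¹ =
      Real.exp (-(1 / 2) * ‖D l'‖ ^ 2 + ⟪dstar v, D l'⟫_ℝ - ⟪f, D l'⟫_ℝ) * Z' *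
        (∫ l, Real.exp (-(1 / 2) * ‖D l‖ ^ 2 + ⟪dstar v, D l⟫_ℝ) ∂ν)⁻¹ := by
  -- translation λ → λ − λ′ in the denominator
  have htr : ∫ l, Real.exp (-(1 / 2) * ‖dstar v - D l' - D l‖ ^ 2) ∂ν =
      ∫ l, Real.exp (-(1 / 2) * ‖dstar v - D l‖ ^ 2) ∂ν := by
    have h : (fun l => Real.exp (-(1 / 2) * ‖dstar v - D l' - D l‖ ^ 2)) =
        fun l => (fun l'' => Real.exp (-(1 / 2) * ‖dstar v - D l''‖ ^ 2)) (l' + l) := by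
      funext l; simp only [map_add, sub_sub]
    rw [h]
    exact integral_add_left_eq_self (fun l'' => Real.exp (-(1 / 2) * ‖dstar v - D l''‖ ^ 2)) l'
  -- expand the square in the denominator and pull out `e^{−½‖∂*A‖²}`
  have hden : ∫ l, Real.exp (-(1 / 2) * ‖dstar v - D l‖ ^ 2) ∂ν =
      Real.exp (-(1 / 2) * ‖dstar v‖ ^ 2) * ∫ l, Real.exp (-(1 / 2) * ‖D l‖ ^ 2 + ⟪dstar v, D l⟫_ℝ) ∂ν := by
    rw [← integral_const_mul]
    congr 1
    funext l
    rw [← Real.exp_add, norm_sub_sq_real]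
    congr 1; ring
  rw [htr, hden, hs, zero_sub, inner_neg_right, norm_sub_sq_real, mul_inv, ← Real.exp_neg]
  have h1 : Real.exp (-(1 / 2) * (‖dstar v‖ ^ 2 - 2 * ⟪dstar v, D l'⟫_ℝ + ‖D l'‖ ^ 2) + -⟪f, D l'⟫_ℝ) =
      Real.exp (-(1 / 2) * ‖D l'‖ ^ 2 + ⟪dstar v, D l'⟫_ℝ - ⟪f, D l'⟫_ℝ) * Real.exp (-(1 / 2) * ‖dstar v‖ ^ 2) := by
    rw [← Real.exp_add]; congr 1; ring
  have h2 : Real.exp (-(1 / 2) * ‖dstar v‖ ^ 2) * Real.exp (-(-(1 / 2) * ‖dstar v‖ ^ 2)) = 1 := by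
    rw [← Real.exp_add, add_neg_cancel, Real.exp_zero]
  calc Real.exp (-(1 / 2) * (‖dstar v‖ ^ 2 - 2 * ⟪dstar v, D l'⟫_ℝ + ‖D l'‖ ^ 2) + -⟪f, D l'⟫_ℝ) * Z' *
        (Real.exp (-(-(1 / 2) * ‖dstar v‖ ^ 2)) * (∫ l, Real.exp (-(1 / 2) * ‖D l‖ ^ 2 + ⟪dstar v, D l⟫_ℝ) ∂ν)⁻¹)
      = Real.exp (-(1 / 2) * ‖D l'‖ ^ 2 + ⟪dstar v, D l'⟫_ℝ - ⟪f, D l'⟫_ℝ) * Z' *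
          (Real.exp (-(1 / 2) * ‖dstar v‖ ^ 2) * Real.exp (-(-(1 / 2) * ‖dstar v‖ ^ 2))) *
          (∫ l, Real.exp (-(1 / 2) * ‖D l‖ ^ 2 + ⟪dstar v, D l⟫_ℝ) ∂ν)⁻¹ := by rw [h1]; ring
    _ = _ := by rw [h2, mul_one]

/-- **(2.30), third line — the two Gaussian `λ`-integrals evaluated** (covariance `𝒢` of `dλδ(Q′λ)e^{−½‖Δλ‖²}`, i.e.
(2.25) twice): for `Z′ ≠ 0`,
`∫dλ′δ(Q′λ′)e^{−½‖Δλ′‖²+⟨Δ(∂*A−f),λ′⟩} · (∫dλδ(Q′λ)e^{−½‖Δλ‖²+⟨Δ∂*A,λ⟩})⁻¹ = e^{−⟨∂*A,Rf⟩+½⟨f,Rf⟩}`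
(= the printed `e^{−⟨Δ∂*A,𝒢Δf⟩+½⟨Δf,𝒢Δf⟩}` by (2.26) `R = Δ𝒢Δ`, see `eq230_line3_calG`).
[cite: Balaban1984PropagatorsII, (2.30) p.227] -/
theorem eq230_line3 (ν : Measure N) [ν.IsAddLeftInvariant] (dstar : A →ₗ[ℝ] V) (Rp : V →ₗ[ℝ] V)
    (D : N →ₗ[ℝ] V) (K : Submodule ℝ V) [K.HasOrthogonalProjection] (hK : LinearMap.range D = K)
    (hR : ∀ g, Rp g = K.starProjection g) (hZ' : ∫ l, Real.exp (-(1 / 2) * ‖D l‖ ^ 2) ∂ν ≠ 0) (f : V)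
    (v : A) :
    (∫ l', Real.exp (-(1 / 2) * ‖D l'‖ ^ 2 + ⟪dstar v, D l'⟫_ℝ - ⟪f, D l'⟫_ℝ) ∂ν) *
        (∫ l, Real.exp (-(1 / 2) * ‖D l‖ ^ 2 + ⟪dstar v, D l⟫_ℝ) ∂ν)⁻¹ =
      Real.exp (-⟪dstar v, Rp f⟫_ℝ + (1 / 2) * ⟪f, Rp f⟫_ℝ) := by
  have hnum : ∫ l', Real.exp (-(1 / 2) * ‖D l'‖ ^ 2 + ⟪dstar v, D l'⟫_ℝ - ⟪f, D l'⟫_ℝ) ∂ν =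
      Real.exp ((1 / 2) * ⟪dstar v - f, Rp (dstar v - f)⟫_ℝ) * ∫ l, Real.exp (-(1 / 2) * ‖D l‖ ^ 2) ∂ν := by
    have hf : (fun l' => Real.exp (-(1 / 2) * ‖D l'‖ ^ 2 + ⟪dstar v, D l'⟫_ℝ - ⟪f, D l'⟫_ℝ)) =
        fun l => Real.exp (-(1 / 2) * ‖D l‖ ^ 2 + ⟪dstar v - f, D l⟫_ℝ) := by
      funext l; rw [inner_sub_left, add_sub_assoc]
    rw [hf, B6Eq295.eq225 ν D K hK Rp hR (dstar v - f)]
  have hden := B6Eq295.eq225 ν D K hK Rp hR (dstar v)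
  rw [hnum, hden, mul_inv, mul_mul_mul_comm, mul_inv_cancel₀ hZ', mul_one, ← Real.exp_neg, ← Real.exp_add]
  congr 1
  rw [map_sub, inner_sub_left, inner_sub_right, inner_sub_right, ← R_symm K Rp hR f (dstar v),
    ← real_inner_comm (Rp f) (dstar v)]
  ring

/-- **(2.30), third line in the printed letters** — with `𝒢` a covariance of (2.25), `R = Δ𝒢Δ` ((2.26); here: Δ on
scalars `lapV`, symmetric, so `⟨x,Ry⟩ = ⟨Δx,𝒢Δy⟩`): `e^{−⟨Δ∂*A,𝒢Δf⟩+½⟨Δf,𝒢Δf⟩} = e^{−⟨∂*A,Rf⟩+½⟨f,Rf⟩}`, and on the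
support of `δ_R(R∂*A)` this is `e^{½⟨f,Rf⟩}` — *"The last equality follows from the identity (2.26) and from the presence
of the δ-function δ_R(R∂*A)"*. [cite: Balaban1984PropagatorsII, (2.30) p.227] -/
theorem eq230_line3_calG (lapV calG Rp : V →ₗ[ℝ] V) (dstar : A →ₗ[ℝ] V) (K : Submodule ℝ V)
    [K.HasOrthogonalProjection] (hR : ∀ g, Rp g = K.starProjection g)
    (h226 : ∀ x y : V, ⟪x, Rp y⟫_ℝ = ⟪lapV x, calG (lapV y)⟫_ℝ) (f : V) {v : A} (hs : Rp (dstar v) = 0) :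
    Real.exp (-⟪lapV (dstar v), calG (lapV f)⟫_ℝ + (1 / 2) * ⟪lapV f, calG (lapV f)⟫_ℝ) =
      Real.exp ((1 / 2) * ⟪f, Rp f⟫_ℝ) := by
  rw [← h226, ← h226, ← R_symm K Rp hR, hs, inner_zero_left, neg_zero, zero_add]

/-- The last equality of (2.30) in the `R`-letters: on the support of `δ_R(R∂*A)`,
`e^{−⟨∂*A,Rf⟩+½⟨f,Rf⟩} = e^{½⟨f,Rf⟩}`. [cite: Balaban1984PropagatorsII, (2.30) p.227] -/
theorem eq230_last (Rp : V →ₗ[ℝ] V) (dstar : A →ₗ[ℝ] V) (K : Submodule ℝ V) [K.HasOrthogonalProjection]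
    (hR : ∀ g, Rp g = K.starProjection g) (f : V) {v : A} (hs : Rp (dstar v) = 0) :
    Real.exp (-⟪dstar v, Rp f⟫_ℝ + (1 / 2) * ⟪f, Rp f⟫_ℝ) = Real.exp ((1 / 2) * ⟪f, Rp f⟫_ℝ) := by
  rw [← R_symm K Rp hR, hs, inner_zero_left, neg_zero, zero_add]

/-- **The orbit integral of the (2.28)₁ integrand over the gauge orbit of a slice configuration** (lines 1–3 of
(2.30) composed, in the `Δ_a`-form): for `R∂*A₀ = 0`,
`∫dλ′δ(Q′λ′) e^{−½⟨A₀^{λ′},Δ_aA₀^{λ′}⟩ + ⟨f,R∂*A₀^{λ′}⟩} = e^{−½‖∂A₀‖²−½⟨QA₀,aQA₀⟩} · e^{½⟨f,Rf⟩} Z′`.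
[cite: Balaban1984PropagatorsII, (2.30) p.227] -/
theorem orbit_integral_230 (ν : Measure N) [ν.IsAddLeftInvariant] (M : A →ₗ[ℝ] A) (curl : A →ₗ[ℝ] T)
    (dstar : A →ₗ[ℝ] V) (Rp : V →ₗ[ℝ] V) (Q : A →ₗ[ℝ] W) (a : W →ₗ[ℝ] W) (D : N →ₗ[ℝ] V) (dN : N →ₗ[ℝ] A)
    (K : Submodule ℝ V) [K.HasOrthogonalProjection] (hK : LinearMap.range D = K)
    (hR : ∀ g, Rp g = K.starProjection g)
    (hform : ∀ v, ⟪v, M v⟫_ℝ = ‖curl v‖ ^ 2 + ⟪dstar v, Rp (dstar v)⟫_ℝ + ⟪Q v, a (Q v)⟫_ℝ)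
    (hcurl : ∀ l, curl (dN l) = 0) (hQ : ∀ l, Q (dN l) = 0) (hD : ∀ l, dstar (dN l) = D l) (f : V) {v : A}
    (hs : Rp (dstar v) = 0) :
    ∫ l', Real.exp (-(1 / 2) * ⟪v - dN l', M (v - dN l')⟫_ℝ + ⟪f, Rp (dstar (v - dN l'))⟫_ℝ) ∂ν =
      Real.exp (-(1 / 2) * ‖curl v‖ ^ 2 - (1 / 2) * ⟪Q v, a (Q v)⟫_ℝ) *
        (Real.exp ((1 / 2) * ⟪f, Rp f⟫_ℝ) * ∫ l, Real.exp (-(1 / 2) * ‖D l‖ ^ 2) ∂ν) := by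
  have hpt : ∀ l', Real.exp (-(1 / 2) * ⟪v - dN l', M (v - dN l')⟫_ℝ + ⟪f, Rp (dstar (v - dN l'))⟫_ℝ) =
      Real.exp (-(1 / 2) * ‖curl v‖ ^ 2 - (1 / 2) * ⟪Q v, a (Q v)⟫_ℝ) *
        Real.exp (-(1 / 2) * ‖D l'‖ ^ 2 + ⟪-f, D l'⟫_ℝ) := by
    intro l'
    rw [form_gauge M curl dstar Rp Q a D dN K hK hR hform hcurl hQ hD hs l',
      R_dstar_gauge D K hK Rp hR dstar dN hD v l', hs, zero_sub, inner_neg_right, inner_neg_left, ← Real.exp_add]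
    congr 1; ring
  simp_rw [hpt]
  rw [integral_const_mul, B6Eq295.eq225 ν D K hK Rp hR (-f), map_neg, inner_neg_right, inner_neg_left, neg_neg]

end Display230Pointwise

end Literature.MathematicalPhysics.QuantumFieldTheory.Balaban1983to89.B6Eq228FaddeevPopov

end
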